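import Summits.AtomisticToContinuum.BoseEinsteinCondensation.Theorems.BoxCountShadowExchange
import HarnessLib

/-!
# BoxCountShadowRingShare — continuation of BoxCountShadowExchange: RSH_h ⟸ DL_h (§10, part 2)

Continuation of `BoxCountShadowExchange` (same namespace).  `exchange_cellMass` (`N · Q_B(j) = (j+1) · P(N_B = j+1)`:
the cell mass is the size-biased law of the full count), the functional inequality `ringShareDefect_le`
(`pairWeightOn {Q_{B→nb B}(j) < θ K⁻³ P̄_B(j)} ≤ 2θ + 8·countVariance + K⁻³`), the energy-class input
`GroundStateHorizonDensityLLN` (DL_h: density law of large numbers at the horizon scale), the door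
`horizonRingShare_of_densityLLN : DL_h → RSH_h` (`θ = 1/40`, `s = 1/80`, `K ≥ 3`) and the kernel
`bec_of_displacement₁ : UGS → LOC_h → DL_h → DISP_h → CSUF_h → SUF_h → BoseEinsteinCondensation`.
No instances, no notation, no sorry.
-/

open MeasureTheory Filter Set
open scoped ENNReal NNReal BigOperators

namespace Summit.AtomisticToContinuum.BoseEinsteinCondensation.Theorems.BoxCountShadow

open Literature.MathematicalPhysics.QuantumManyBody.BoseGas
open Summit.AtomisticToContinuum.BoseEinsteinCondensation.Theorems.BoxLatticeFSum
open Summit.AtomisticToContinuum.BoseEinsteinCondensation.Theorems.BoxLabelAffinity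
open Summit.AtomisticToContinuum.BoseEinsteinCondensation.Theorems.BoxHorizonAffinity

variable {n : ℕ}

/-! ### §10 (continued)  The ring-share defect bound and the density door -/

/-- **Exchangeability identity, diagonal case**: `N · Q_B(j) = N · ∫_{m_B(Y) = j} q_B(Y) dY = ∫ N_B(X) 1_{N_B(X) = j+1} Φ²
= (j+1) · Φ²{N_B = j+1}` — the cell mass of §6 is the size-biased law of the FULL count of cell `B`; hence MARG_h / INS_h
are statements about the `K³` laws `p_B` on `ℕ` (`Q_B(j) = (j+1) p_B(j+1)/N`). [folklore] -/
theorem exchange_cellMass {L : ℝ} {K : ℕ} (hL : 0 < L) (hK : 0 < K) {Φ : Config (n + 1) → ℝ}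
    (hΦm : Measurable Φ) (hsym : ∀ (σ : Equiv.Perm (Fin (n + 1))) (X : Config (n + 1)), Φ (X ∘ σ) = Φ X)
    (B : SubIdx K) (j : ℕ) :
    ((n + 1 : ℕ) : ℝ≥0∞) * cellMass L K Φ B j =
      ((j + 1 : ℕ) : ℝ≥0∞) * ∫⁻ X : Config (n + 1),
        {X : Config (n + 1) | countVec (L / (K : ℝ)) K X B = j + 1}.indicator (fun X => ENNReal.ofReal (Φ X) ^ 2) X := by
  have hKr : (0 : ℝ) < K := by exact_mod_cast hK
  have hℓ : 0 < L / (K : ℝ) := div_pos hL hKr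
  set ℓ := L / (K : ℝ) with hℓdef
  set S : Set (Config (n + 1)) := {X | countVec ℓ K X B = j + 1} with hSdef
  have hS : MeasurableSet S := measurableSet_countVec_mem ℓ K B {j + 1}
  have hΦ2 : Measurable fun X => ENNReal.ofReal (Φ X) ^ 2 := hΦm.ennreal_ofReal.pow_const 2
  set G₀ : Config (n + 1) → ℝ≥0∞ := fun X =>
    (subCell ℓ B).indicator (fun _ => (1 : ℝ≥0∞)) (X 0) * S.indicator (fun X => ENNReal.ofReal (Φ X) ^ 2) X
    with hG₀def
  have hG₀m : Measurable G₀ :=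
    ((measurable_const.indicator (measurableSet_subCell ℓ B)).comp (measurable_pi_apply 0)).mul
      (hΦ2.indicator hS)
  have hterm : ∀ i : Fin (n + 1),
      ∫⁻ X, (subCell ℓ B).indicator (fun _ => (1 : ℝ≥0∞)) (X i) *
          S.indicator (fun X => ENNReal.ofReal (Φ X) ^ 2) X = ∫⁻ X, G₀ X := by
    intro i
    have hfun : (fun X : Config (n + 1) => (subCell ℓ B).indicator (fun _ => (1 : ℝ≥0∞)) (X i) *
        S.indicator (fun X => ENNReal.ofReal (Φ X) ^ 2) X) = fun X => G₀ (X ∘ Equiv.swap 0 i) := by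
      funext X
      have h0 : (X ∘ Equiv.swap 0 i) 0 = X i := by
        rw [Function.comp_apply, Equiv.swap_apply_left]
      have hmem : (X ∘ Equiv.swap 0 i ∈ S) ↔ (X ∈ S) := by
        simp only [hSdef, Set.mem_setOf_eq, countVec_comp_perm]
      simp only [hG₀def, h0]
      congr 1
      by_cases hX : X ∈ S
      · rw [Set.indicator_of_mem hX, Set.indicator_of_mem (hmem.2 hX), hsym]
      · rw [Set.indicator_of_notMem hX, Set.indicator_of_notMem (fun h => hX (hmem.1 h))]
    rw [hfun]
    exact lintegral_comp_perm (Equiv.swap 0 i) G₀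
  -- slice computation: for `x ∈ Q_B`, `N_B(x :: Y) = m_B(Y) + 1`
  have hslice : ∀ Y : Config n, ∫⁻ x, G₀ (Matrix.vecCons x Y) =
      (((fun m : SubIdx K → ℕ => m B) ∘ countVec ℓ K) ⁻¹' {j}).indicator (fun Y => blockMass L K Φ B Y) Y := by
    intro Y
    have hpt : ∀ x, G₀ (Matrix.vecCons x Y) =
        (((fun m : SubIdx K → ℕ => m B) ∘ countVec ℓ K) ⁻¹' {j}).indicator
          (fun Y => (subCell ℓ B).indicator (fun x => ENNReal.ofReal (Φ (Matrix.vecCons x Y)) ^ 2) x) Y := by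
      intro x
      simp only [hG₀def, Matrix.cons_val_zero]
      by_cases hx : x ∈ subCell ℓ B
      · have hcnt : countVec ℓ K (Matrix.vecCons x Y : Config (n + 1)) B = countVec ℓ K Y B + 1 := by
          rw [countVec_vecCons, Set.indicator_of_mem hx, add_comm]
        have hiff : (Matrix.vecCons x Y : Config (n + 1)) ∈ S ↔
            Y ∈ ((fun m : SubIdx K → ℕ => m B) ∘ countVec ℓ K) ⁻¹' {j} := by
          simp only [hSdef, Set.mem_setOf_eq, hcnt, Set.mem_preimage, Function.comp_apply,
            Set.mem_singleton_iff, add_left_inj]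
        rw [Set.indicator_of_mem hx, one_mul]
        by_cases hY : Y ∈ ((fun m : SubIdx K → ℕ => m B) ∘ countVec ℓ K) ⁻¹' {j}
        · rw [Set.indicator_of_mem (hiff.2 hY), Set.indicator_of_mem hY, Set.indicator_of_mem hx]
        · rw [Set.indicator_of_notMem (fun h => hY (hiff.1 h)), Set.indicator_of_notMem hY]
      · rw [Set.indicator_of_notMem hx, zero_mul]
        by_cases hY : Y ∈ ((fun m : SubIdx K → ℕ => m B) ∘ countVec ℓ K) ⁻¹' {j}
        · rw [Set.indicator_of_mem hY, Set.indicator_of_notMem hx]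
        · rw [Set.indicator_of_notMem hY]
    simp_rw [hpt]
    by_cases hY : Y ∈ ((fun m : SubIdx K → ℕ => m B) ∘ countVec ℓ K) ⁻¹' {j}
    · simp only [Set.indicator_of_mem hY]
      rw [lintegral_indicator (measurableSet_subCell ℓ B)]
      rfl
    · simp only [Set.indicator_of_notMem hY, lintegral_zero]
  have hT : Measurable ((fun m : SubIdx K → ℕ => m B) ∘ countVec (n := n) ℓ K) :=
    (measurable_pi_apply B).comp (measurable_countVec ℓ K)
  have hfib : MeasurableSet (((fun m : SubIdx K → ℕ => m B) ∘ countVec (n := n) ℓ K) ⁻¹' {j}) :=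
    hT MeasurableSet.of_discrete
  have hG₀int : ∫⁻ X, G₀ X = cellMass L K Φ B j := by
    rw [lintegral_eq_lintegral_lintegral_vecCons hG₀m]
    simp_rw [hslice]
    exact lintegral_indicator hfib _
  -- `Σ_i 1_{x_i ∈ Q_B} 1_S = N_B 1_S = (j+1) 1_S`
  have hsum : ∀ X : Config (n + 1), ∑ i : Fin (n + 1), (subCell ℓ B).indicator (fun _ => (1 : ℝ≥0∞)) (X i) *
      S.indicator (fun X => ENNReal.ofReal (Φ X) ^ 2) X =
        ((j + 1 : ℕ) : ℝ≥0∞) * S.indicator (fun X => ENNReal.ofReal (Φ X) ^ 2) X := by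
    intro X
    rw [← Finset.sum_mul, ← natCast_countVec]
    by_cases hX : X ∈ S
    · have hc : countVec ℓ K X B = j + 1 := hX
      rw [hc]
    · rw [Set.indicator_of_notMem hX, mul_zero, mul_zero]
  calc ((n + 1 : ℕ) : ℝ≥0∞) * cellMass L K Φ B j = ((n + 1 : ℕ) : ℝ≥0∞) * ∫⁻ X, G₀ X := by rw [hG₀int]
    _ = ∑ _i : Fin (n + 1), ∫⁻ X, G₀ X := by
        rw [Finset.sum_const, Finset.card_univ, Fintype.card_fin, nsmul_eq_mul]
    _ = ∑ i : Fin (n + 1), ∫⁻ X, (subCell ℓ B).indicator (fun _ => (1 : ℝ≥0∞)) (X i) *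
          S.indicator (fun X => ENNReal.ofReal (Φ X) ^ 2) X := Finset.sum_congr rfl fun i _ => (hterm i).symm
    _ = ∫⁻ X, ∑ i : Fin (n + 1), (subCell ℓ B).indicator (fun _ => (1 : ℝ≥0∞)) (X i) *
          S.indicator (fun X => ENNReal.ofReal (Φ X) ^ 2) X := by
        refine (lintegral_finsetSum _ fun i _ => ?_).symm
        exact ((measurable_const.indicator (measurableSet_subCell ℓ B)).comp (measurable_pi_apply i)).mul
          (hΦ2.indicator hS)
    _ = ((j + 1 : ℕ) : ℝ≥0∞) * ∫⁻ X, S.indicator (fun X => ENNReal.ofReal (Φ X) ^ 2) X := by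
        rw [← lintegral_const_mul _ (hΦ2.indicator hS)]
        exact lintegral_congr hsum

/-- **The ring-share defect bound.** For a Bose-symmetric normalised amplitude and `K ≥ 2`, the pairs `(B, j)` at
which the designated neighbour `nb B` receives the tagged particle at rate `< θ·K⁻³P̄_B(j)` on the fibre `m_B = j`
have total weight `≤ 2θ + 8·countVariance + K⁻³` (exchangeability, Markov at level `λ/2` for `N_{nb B}`, Chebyshev
for `N_{nb B} ≤ λ/2`, and each cell is `nb` of at most two cells). [folklore] -/
theorem ringShareDefect_le {L : ℝ} {K : ℕ} (hL : 0 < L) (hK2 : 2 ≤ K) {Φ : Config (n + 1) → ℝ}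
    (hΦm : Measurable Φ) (hsym : ∀ (σ : Equiv.Perm (Fin (n + 1))) (X : Config (n + 1)), Φ (X ∘ σ) = Φ X)
    (hΦ1 : ∫⁻ Y : Config n, ∫⁻ x, ENNReal.ofReal (Φ (Matrix.vecCons x Y)) ^ 2 = 1) (θ : ℝ≥0∞) :
    pairWeightOn L K Φ {p | cellPairMass L K Φ p.1 (nb p.1) p.2 < θ * pairWeight L K Φ p} ≤
      2 * θ + 8 * countVariance L K Φ + blockWeight K ^ 2 := by
  have hK : 0 < K := lt_of_lt_of_le two_pos hK2
  have hKr : (0 : ℝ) < K := by exact_mod_cast hK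
  have hNr : (0 : ℝ) < ((n + 1 : ℕ) : ℝ) := by positivity
  set lam : ℝ := ((n + 1 : ℕ) : ℝ) / (K : ℝ) ^ 3 with hlamdef
  have hlam : 0 < lam := by positivity
  set D : Set (SubIdx K × ℕ) := {p | cellPairMass L K Φ p.1 (nb p.1) p.2 < θ * pairWeight L K Φ p}
    with hDdef
  set Dc : SubIdx K → Set ℕ := fun B => {j | (B, j) ∈ D} with hDcdef
  set S : SubIdx K → Set (Config (n + 1)) := fun B => {X | countVec (L / (K : ℝ)) K X B ∈ Dc B} with hSdef
  have hS : ∀ B, MeasurableSet (S B) := fun B => measurableSet_countVec_mem (L / (K : ℝ)) K B (Dc B)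
  have hΦ2 : Measurable fun X => ENNReal.ofReal (Φ X) ^ 2 := hΦm.ennreal_ofReal.pow_const 2
  have hT : ∀ B, Measurable ((fun m : SubIdx K → ℕ => m B) ∘ countVec (n := n) (L / (K : ℝ)) K) := fun B =>
    (measurable_pi_apply B).comp (measurable_countVec (L / (K : ℝ)) K)
  have hNm : ∀ B, Measurable fun X : Config (n + 1) => ((countVec (L / (K : ℝ)) K X B : ℕ) : ℝ≥0∞) := fun B =>
    measurable_natCast_ennreal_countVec B
  -- the variance terms
  set V : SubIdx K → ℝ≥0∞ := fun B => ∫⁻ X : Config (n + 1),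
    ENNReal.ofReal ((((countVec (L / (K : ℝ)) K X B : ℕ) : ℝ) / lam - 1) ^ 2) * ENNReal.ofReal (Φ X) ^ 2
    with hVdef
  have hCV : countVariance L K Φ = ∑ B, blockWeight K ^ 2 * V B := rfl
  -- Step 1: the defect weight, cell by cell, as tagged fibre integrals
  have h1 : pairWeightOn L K Φ D = ∑ B, blockWeight K ^ 2 *
      ∫⁻ Y in ((fun m : SubIdx K → ℕ => m B) ∘ countVec (L / (K : ℝ)) K) ⁻¹' (Dc B), sliceSq Φ Y := by
    unfold pairWeightOn
    refine Finset.sum_congr rfl fun B _ => ?_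
    rw [← tsum_indicator_fibre volume (hT B) (sliceSq Φ) (Dc B), ← ENNReal.tsum_mul_left]
    refine tsum_congr fun j => ?_
    by_cases hj : (B, j) ∈ D
    · have hj' : j ∈ Dc B := hj
      rw [Set.indicator_of_mem hj, Set.indicator_of_mem hj']
      rfl
    · have hj' : j ∉ Dc B := hj
      rw [Set.indicator_of_notMem hj, Set.indicator_of_notMem hj', mul_zero]
  -- Step 2: on the defect set the designated neighbour's size-biased mass is small
  have h2 : ∀ B, ∫⁻ X, ((countVec (L / (K : ℝ)) K X (nb B) : ℕ) : ℝ≥0∞) *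
      (S B).indicator (fun X => ENNReal.ofReal (Φ X) ^ 2) X ≤
        ((n + 1 : ℕ) : ℝ≥0∞) * (θ * blockWeight K ^ 2) := by
    intro B
    have hne : nb B ≠ B := (nb_mem_nbrs hK2 B).1
    rw [← exchange_cellPairMass hL hK hΦm hsym hne (Dc B),
      ← tsum_indicator_fibre volume (hT B) (blockMass L K Φ (nb B)) (Dc B)]
    gcongr
    have hS1 : ∑' j : ℕ, cellSlice L K Φ B j = 1 := by
      unfold cellSlice
      rw [← lintegral_eq_tsum_fibre volume (hT B) (sliceSq Φ)]
      exact hΦ1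
    calc ∑' j, (Dc B).indicator (fun j => ∫⁻ Y in ((fun m : SubIdx K → ℕ => m B) ∘
              countVec (L / (K : ℝ)) K) ⁻¹' {j}, blockMass L K Φ (nb B) Y) j
        ≤ ∑' j, θ * blockWeight K ^ 2 * cellSlice L K Φ B j := by
          refine ENNReal.tsum_le_tsum fun j => ?_
          by_cases hj : j ∈ Dc B
          · rw [Set.indicator_of_mem hj]
            have hlt : cellPairMass L K Φ B (nb B) j < θ * pairWeight L K Φ (B, j) := hj
            rw [mul_assoc]
            exact hlt.le
          · rw [Set.indicator_of_notMem hj]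
            exact bot_le
      _ = θ * blockWeight K ^ 2 := by rw [ENNReal.tsum_mul_left, hS1, mul_one]
  -- the constant: (2/λ) · N · θ · K⁻³ = 2θ
  have hconst : ENNReal.ofReal (2 / lam) * (((n + 1 : ℕ) : ℝ≥0∞) * (θ * blockWeight K ^ 2)) = 2 * θ := by
    rw [blockWeight_sq hK, ← ENNReal.ofReal_natCast (n + 1)]
    calc ENNReal.ofReal (2 / lam) * (ENNReal.ofReal ((n + 1 : ℕ) : ℝ) * (θ * ENNReal.ofReal (((K : ℝ) ^ 3)⁻¹)))
        = ENNReal.ofReal (2 / lam * ((n + 1 : ℕ) : ℝ) * ((K : ℝ) ^ 3)⁻¹) * θ := by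
          rw [ENNReal.ofReal_mul (by positivity), ENNReal.ofReal_mul (by positivity)]; ring
      _ = 2 * θ := by
          have : 2 / lam * ((n + 1 : ℕ) : ℝ) * ((K : ℝ) ^ 3)⁻¹ = 2 := by
            rw [hlamdef]; field_simp
          rw [this, ENNReal.ofReal_ofNat]
  -- Step 3: Markov + Chebyshev for the full count of the designated neighbour
  have h3 : ∀ B, ∫⁻ X, (S B).indicator (fun X => ENNReal.ofReal (Φ X) ^ 2) X ≤ 2 * θ + 4 * V (nb B) := by
    intro B
    have hmN : Measurable fun X : Config (n + 1) => ((countVec (L / (K : ℝ)) K X (nb B) : ℕ) : ℝ≥0∞) *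
        (S B).indicator (fun X => ENNReal.ofReal (Φ X) ^ 2) X := (hNm (nb B)).mul (hΦ2.indicator (hS B))
    have hmA : Measurable fun X : Config (n + 1) => ENNReal.ofReal (2 / lam) *
        (((countVec (L / (K : ℝ)) K X (nb B) : ℕ) : ℝ≥0∞) *
          (S B).indicator (fun X => ENNReal.ofReal (Φ X) ^ 2) X) := hmN.const_mul _
    have hpt : ∀ X, (S B).indicator (fun X => ENNReal.ofReal (Φ X) ^ 2) X ≤
        ENNReal.ofReal (2 / lam) * (((countVec (L / (K : ℝ)) K X (nb B) : ℕ) : ℝ≥0∞) *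
            (S B).indicator (fun X => ENNReal.ofReal (Φ X) ^ 2) X) +
          4 * (ENNReal.ofReal ((((countVec (L / (K : ℝ)) K X (nb B) : ℕ) : ℝ) / lam - 1) ^ 2) *
            ENNReal.ofReal (Φ X) ^ 2) := by
      intro X
      have h := le_markov_add_chebyshev hlam (countVec (L / (K : ℝ)) K X (nb B))
        (Set.indicator_le_self (S B) (fun X => ENNReal.ofReal (Φ X) ^ 2) X)
      rw [ENNReal.ofReal_mul (by positivity), ENNReal.ofReal_natCast] at h
      simpa only [mul_assoc] using h
    calc ∫⁻ X, (S B).indicator (fun X => ENNReal.ofReal (Φ X) ^ 2) X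
        ≤ ∫⁻ X, (ENNReal.ofReal (2 / lam) * (((countVec (L / (K : ℝ)) K X (nb B) : ℕ) : ℝ≥0∞) *
            (S B).indicator (fun X => ENNReal.ofReal (Φ X) ^ 2) X) +
          4 * (ENNReal.ofReal ((((countVec (L / (K : ℝ)) K X (nb B) : ℕ) : ℝ) / lam - 1) ^ 2) *
            ENNReal.ofReal (Φ X) ^ 2)) := lintegral_mono hpt
      _ = ENNReal.ofReal (2 / lam) * (∫⁻ X, ((countVec (L / (K : ℝ)) K X (nb B) : ℕ) : ℝ≥0∞) *
            (S B).indicator (fun X => ENNReal.ofReal (Φ X) ^ 2) X) + 4 * V (nb B) := by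
          rw [lintegral_add_left hmA, lintegral_const_mul _ hmN,
            lintegral_const_mul _ (measurable_varTerm (nb B) lam hΦm)]
      _ ≤ 2 * θ + 4 * V (nb B) := by
          rw [← hconst]
          exact add_le_add (mul_le_mul' le_rfl (h2 B)) le_rfl
  -- Step 4: the tagged correction Σ_B K⁻³ ∫ q_B ≤ K⁻³
  have h4 : ∑ B : SubIdx K, blockWeight K ^ 2 * ∫⁻ Y, blockMass L K Φ B Y ≤ blockWeight K ^ 2 := by
    rw [← Finset.mul_sum, ← lintegral_finsetSum _ fun B _ => measurable_blockMass L K hΦm B]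
    calc blockWeight K ^ 2 * ∫⁻ Y, ∑ B, blockMass L K Φ B Y ≤ blockWeight K ^ 2 * ∫⁻ Y, sliceSq Φ Y :=
          mul_le_mul' le_rfl (lintegral_mono fun Y => sum_blockMass_le_sliceSq hL hK hΦm Y)
      _ = blockWeight K ^ 2 := by
          have : ∫⁻ Y, sliceSq Φ Y = 1 := hΦ1
          rw [this, mul_one]
  -- assemble
  have ha : ∑ B : SubIdx K, blockWeight K ^ 2 * (2 * θ) ≤ 2 * θ := by
    rw [← Finset.sum_mul, sum_blockWeight_sq hK, one_mul]
  have hb : ∑ B : SubIdx K, blockWeight K ^ 2 * (4 * V (nb B)) ≤ 8 * countVariance L K Φ :=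
    calc ∑ B : SubIdx K, blockWeight K ^ 2 * (4 * V (nb B))
        = blockWeight K ^ 2 * (4 * ∑ B : SubIdx K, V (nb B)) := by rw [← Finset.mul_sum, ← Finset.mul_sum]
      _ ≤ blockWeight K ^ 2 * (4 * (2 * ∑ B : SubIdx K, V B)) :=
          mul_le_mul' le_rfl (mul_le_mul' le_rfl (sum_nb_le V))
      _ = 8 * (blockWeight K ^ 2 * ∑ B : SubIdx K, V B) := by ring
      _ = 8 * countVariance L K Φ := by rw [hCV, Finset.mul_sum]
  have hper : ∀ B : SubIdx K, blockWeight K ^ 2 *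
      ∫⁻ Y in ((fun m : SubIdx K → ℕ => m B) ∘ countVec (L / (K : ℝ)) K) ⁻¹' (Dc B), sliceSq Φ Y ≤
        blockWeight K ^ 2 * (2 * θ) + (blockWeight K ^ 2 * (4 * V (nb B)) +
          blockWeight K ^ 2 * ∫⁻ Y, blockMass L K Φ B Y) := by
    intro B
    rw [← mul_add, ← mul_add]
    refine mul_le_mul' le_rfl ?_
    calc ∫⁻ Y in ((fun m : SubIdx K → ℕ => m B) ∘ countVec (L / (K : ℝ)) K) ⁻¹' (Dc B), sliceSq Φ Y
        ≤ (∫⁻ X, (S B).indicator (fun X => ENNReal.ofReal (Φ X) ^ 2) X) + ∫⁻ Y, blockMass L K Φ B Y :=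
          cellSlice_le_full hΦm B (Dc B)
      _ ≤ (2 * θ + 4 * V (nb B)) + ∫⁻ Y, blockMass L K Φ B Y := add_le_add (h3 B) le_rfl
      _ = 2 * θ + (4 * V (nb B) + ∫⁻ Y, blockMass L K Φ B Y) := add_assoc _ _ _
  rw [h1]
  calc ∑ B, blockWeight K ^ 2 *
          ∫⁻ Y in ((fun m : SubIdx K → ℕ => m B) ∘ countVec (L / (K : ℝ)) K) ⁻¹' (Dc B), sliceSq Φ Y
      ≤ ∑ B, (blockWeight K ^ 2 * (2 * θ) + (blockWeight K ^ 2 * (4 * V (nb B)) +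
          blockWeight K ^ 2 * ∫⁻ Y, blockMass L K Φ B Y)) := Finset.sum_le_sum fun B _ => hper B
    _ = ∑ B, blockWeight K ^ 2 * (2 * θ) + (∑ B, blockWeight K ^ 2 * (4 * V (nb B)) +
          ∑ B, blockWeight K ^ 2 * ∫⁻ Y, blockMass L K Φ B Y) := by
        rw [Finset.sum_add_distrib, Finset.sum_add_distrib]
    _ ≤ 2 * θ + (8 * countVariance L K Φ + blockWeight K ^ 2) := add_le_add ha (add_le_add hb h4)
    _ = 2 * θ + 8 * countVariance L K Φ + blockWeight K ^ 2 := (add_assoc _ _ _).symm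

/-- **DL_h(η)** (door input · TAG ENERGY-CLASS · TRUE-type (rate `(ρa³)^{1/2+η_J}` expected) · WEAKER than the
conjunct (number-locked and half-filled-lattice states satisfy it) · leaf ATTACKABLE·L, class = COERCIVITY OF THE
ENERGY IN THE COARSE DENSITY) `GroundStateHorizonDensityLLN η`: for `a > 0`, every target `s > 0` and every horizon
constant `M > 0`, below a density cap, eventually in `N`, for every `K` of the horizon window the mean-square relative
fluctuation of the FULL horizon-cell counts of the ground state is `≤ s`:
`Σ_B K⁻³ E_{Ψ₀²}(N_B/λ − 1)² ≤ s`, `λ = N/K³` — the density law of large numbers at scale `ℓ_h` (mean `λ → ∞`).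
Mechanism in print: the cell energies are LHY-sharp given the cell occupations inside the sighted region
`R ≥ L_J` of the pinned lower bound [Junge2026, Cor. 6], `e(ρ) = 4πaρ²(1 + …)` is strictly convex, and the global
upper bound is LHY-sharp [LSSY2005, Thm 7.1; Fournais–Solovej / Basti–Cenatiempo–Schlein], so
`4πa ρ² · E Σ_B |Q_B| (N_B/λ − 1)² ≲ (E^{up} − E^{low}_{main}) = O(aρ²L³(ρa³)^{1/2+η_J})`.  Why it might fail: the
transfer of the boxwise pinned bound to the conditional cell states of the Dirichlet minimiser (the LOC_h caveat),
and the uniform treatment of boundary cells.  NOT implied by LOC_h (half-filled lattice state) nor implying it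
(number-locked state). [cite: Junge2026, Cor. 6 (26); LSSY2005, Thm 7.1] -/
@[conjecture] def GroundStateHorizonDensityLLN (η : ℝ≥0) : Prop :=
  ∀ v : ℝ → ℝ≥0∞, IsRepulsiveFiniteRange v → 0 < scatteringLength v →
    ∀ s : ℝ, 0 < s → ∀ M : ℝ, 0 < M → ∃ ρ₀ : ℝ, 0 < ρ₀ ∧ ∀ ρ : ℝ, 0 < ρ → ρ < ρ₀ →
      ∀ᶠ n : ℕ in atTop,
        (∃ Ψ₀ : Config (n + 1) → ℝ, (∀ X, 0 ≤ Ψ₀ X) ∧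
          IsGroundState v (sideLength ρ (n + 1)) (fun X => (Ψ₀ X : ℂ))) →
        ∀ K : ℕ, 0 < K → InWindow (M * ρ ^ (-(η : ℝ))) ρ (sideLength ρ (n + 1)) K →
          countVariance (sideLength ρ (n + 1)) K (groundState v (n + 1) (sideLength ρ (n + 1))) ≤
            ENNReal.ofReal s

/-- In the window, `K ≥ 3` once the box side is `≥ 3 · (2A/√ρ)`. [folklore] -/
theorem three_le_of_inWindow {A ρ L : ℝ} {K : ℕ} (hA : 0 < A) (hρ : 0 < ρ) (hK : 0 < K)
    (hw : InWindow A ρ L K) (hL : 3 * (2 * A / Real.sqrt ρ) ≤ L) : 3 ≤ K := by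
  have hu : 0 < 2 * A / Real.sqrt ρ := by positivity
  have hKr : (0 : ℝ) < K := by exact_mod_cast hK
  have hL' : L ≤ 2 * A / Real.sqrt ρ * (K : ℝ) := by
    have h2 := hw.2
    rwa [div_le_iff₀ hKr] at h2
  have h3 : 2 * A / Real.sqrt ρ * 3 ≤ 2 * A / Real.sqrt ρ * (K : ℝ) := by linarith [hL.trans hL']
  have : (3 : ℝ) ≤ K := le_of_mul_le_mul_left h3 hu
  exact_mod_cast this

/-- **DL_h ⟹ RSH_h** (`θ = 1/40`, any `M₀`; from `ringShareDefect_le` with `s = 1/80` and `K ≥ 3`):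
the density law of large numbers at the horizon scale gives the ring share. [folklore] -/
theorem horizonRingShare_of_densityLLN (η : ℝ≥0) (hdl : GroundStateHorizonDensityLLN η) :
    GroundStateHorizonRingShare η := by
  intro v hv ha
  refine ⟨1, one_pos, fun M hM => ?_⟩
  have hMpos : 0 < M := lt_of_lt_of_le one_pos hM
  obtain ⟨ρ₀, hρ₀, h⟩ := hdl v hv ha (1 / 80) (by norm_num) M hMpos
  refine ⟨1 / 40, by norm_num, ρ₀, hρ₀, fun ρ hρ hρlt => ?_⟩
  have hA : 0 < M * ρ ^ (-(η : ℝ)) := mul_pos hMpos (Real.rpow_pos_of_pos hρ _)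
  have hev : ∀ᶠ n : ℕ in atTop, 3 * (2 * (M * ρ ^ (-(η : ℝ))) / Real.sqrt ρ) ≤ sideLength ρ (n + 1) :=
    (tendsto_add_atTop_nat 1).eventually ((tendsto_sideLength_atTop hρ).eventually_ge_atTop _)
  filter_upwards [h ρ hρ hρlt, hev] with n hn hLn hex K hK hKw
  set L := sideLength ρ (n + 1) with hLdef
  have hL : 0 < L := sideLength_pos_of_inWindow hA hρ hK hKw
  have hK3 : 3 ≤ K := three_le_of_inWindow hA hρ hK hKw hLn
  have hK2 : 2 ≤ K := le_trans (by norm_num) hK3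
  set Φ := groundState v (n + 1) L with hΦdef
  have hΦm : Measurable Φ := measurable_groundState v (n + 1) L
  have hsym : ∀ (σ : Equiv.Perm (Fin (n + 1))) (X : Config (n + 1)), Φ (X ∘ σ) = Φ X :=
    fun σ X => groundState_comp_perm v L σ X
  have hΦ1 : ∫⁻ Y : Config n, ∫⁻ x, ENNReal.ofReal (Φ (Matrix.vecCons x Y)) ^ 2 = 1 := by
    rw [← lintegral_eq_lintegral_lintegral_vecCons (hΦm.ennreal_ofReal.pow_const 2)]
    exact lintegral_groundState_sq hex
  have hCV : countVariance L K Φ ≤ ENNReal.ofReal (1 / 80) := hn hex K hK hKw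
  set D : Set (SubIdx K × ℕ) :=
    {p | cellPairMass L K Φ p.1 (nb p.1) p.2 < ENNReal.ofReal (1 / 40) * pairWeight L K Φ p} with hDdef
  have hD := ringShareDefect_le hL hK2 hΦm hsym hΦ1 (ENNReal.ofReal (1 / 40))
  refine ⟨Dᶜ, ?_, ?_⟩
  · rw [compl_compl]
    have e1 : (2 : ℝ≥0∞) * ENNReal.ofReal (1 / 40) = ENNReal.ofReal (1 / 20) := by
      rw [show (1 / 20 : ℝ) = 2 * (1 / 40) by norm_num, ENNReal.ofReal_mul (by norm_num : (0 : ℝ) ≤ 2),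
        ENNReal.ofReal_ofNat]
    have e2 : (8 : ℝ≥0∞) * ENNReal.ofReal (1 / 80) = ENNReal.ofReal (1 / 10) := by
      rw [show (1 / 10 : ℝ) = 8 * (1 / 80) by norm_num, ENNReal.ofReal_mul (by norm_num : (0 : ℝ) ≤ 8),
        ENNReal.ofReal_ofNat]
    have e3 : blockWeight K ^ 2 ≤ ENNReal.ofReal (1 / 27) := by
      rw [blockWeight_sq hK]
      apply ENNReal.ofReal_le_ofReal
      have hK3r : (3 : ℝ) ≤ K := by exact_mod_cast hK3
      have h27 : (27 : ℝ) ≤ (K : ℝ) ^ 3 :=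
        calc (27 : ℝ) = 3 ^ 3 := by norm_num
          _ ≤ (K : ℝ) ^ 3 := pow_le_pow_left₀ (by norm_num) hK3r 3
      rw [one_div]
      exact inv_anti₀ (by norm_num) h27
    have hquarter : (1 / 4 : ℝ≥0∞) = ENNReal.ofReal (1 / 4) := by
      rw [ENNReal.ofReal_div_of_pos (by norm_num : (0 : ℝ) < 4), ENNReal.ofReal_one, ENNReal.ofReal_ofNat]
    calc pairWeightOn L K Φ D
        ≤ 2 * ENNReal.ofReal (1 / 40) + 8 * countVariance L K Φ + blockWeight K ^ 2 := hD
      _ ≤ ENNReal.ofReal (1 / 20) + ENNReal.ofReal (1 / 10) + ENNReal.ofReal (1 / 27) :=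
          add_le_add (add_le_add e1.le ((mul_le_mul' le_rfl hCV).trans_eq e2)) e3
      _ = ENNReal.ofReal (1 / 20 + 1 / 10 + 1 / 27) := by
          rw [ENNReal.ofReal_add (by norm_num) (by norm_num), ENNReal.ofReal_add (by norm_num) (by norm_num)]
      _ ≤ 1 / 4 := by
          rw [hquarter]
          exact ENNReal.ofReal_le_ofReal (by norm_num)
  · intro B j hp
    refine ⟨nb B, nb_mem_nbrs hK2 B, ?_⟩
    have hp' : ¬ (cellPairMass L K Φ B (nb B) j < ENNReal.ofReal (1 / 40) * pairWeight L K Φ (B, j)) := hp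
    exact not_lt.1 hp'

/-- The kernel through the displacement door with the ring share discharged by the density law of large numbers:
UGS → LOC_h(η) → DL_h(η) → DISP_h(η) → CSUF_h(η) → SUF_h(η) → `BoseEinsteinCondensation`. [folklore] -/
theorem bec_of_displacement₁ (η : ℝ≥0) (hU : BoxGroundStateUniqueness)
    (hloc : GroundStateHorizonCondensation η) (hdl : GroundStateHorizonDensityLLN η)
    (hdisp : GroundStateHorizonDisplacement η) (hcsuf : GroundStateHorizonCellCountSufficiency η)
    (hsuf : GroundStateHorizonCountSufficiency η) : _root_.BoseEinsteinCondensation :=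
  bec_of_displacement₀ η hU hloc hdisp (horizonRingShare_of_densityLLN η hdl) hcsuf hsuf

end Summit.AtomisticToContinuum.BoseEinsteinCondensation.Theorems.BoxCountShadow
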